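import Summits.BirchSwinnertonDyer.BirchSwinnertonDyer.Theorems.AlignedTransportAtTwoMainConjectureOfRankZeroBSDAtTwoFineRoadKleinCountingLambda
import Mathlib.LinearAlgebra.Projection
import HarnessLib

/-!
# Route `AlignedTransportAtTwo`, crux C2 `MainConjectureOfRankZeroBSDAtTwo` (stmt-BirchSwinnertonDyer-22298),
# road (b″): PERFECT DESCENT at `2`, part XI — the `e₁`-SPLITTING over `Λ = ℤ₂⟦T⟧` and the Λ-adic counting lemma
# in its final shape: given `μ` of the norm part `(1 + σ + σ²)X` vanishes (the Ferrero–Washington input),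
# `Hom_{G_∞}(X, V₄)` is finite ⟺ `X` is `Λ`-torsion with `μ(X) = 0`

Cell `bsd-f1-sign2`, WIDTH-5 attach seat `bsd-line-att-p3` (gen 5) on line `birth` of crux C2
(`--supports` stmt-BirchSwinnertonDyer-22298; closes nothing). HONEST FRAMING: THEOREMS ONLY — no definition, no
named fact, no instance, no `sorry`; BSD is NOT proved by any of this. Sequel of part X (`…KleinCountingLambda`:
`Hom_Q(X, V₄)` finite ⟺ `W = ker(1 + σ + σ²)` is `Λ`-torsion with `μ(W) = 0`). PERFECT-DESCENT.md §3 (iii)–(iv) then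
splits `X = e₁X ⊕ (1 − e₁)X` with `e₁ = 3⁻¹(1 + σ + σ²)` («`3 ∈ ℤ₂ˣ`; the central idempotent onto the `C₃`-invariants»)
and disposes of `e₁X = (1 + σ + σ²)X ⊆ j(N_{F/K} X)` by Ferrero–Washington for the quadratic field `K = ℚ(√Δ_E)`. This
file is the module-theoretic half of that step: the splitting, the additivity of `ℓ₍₂₎` along it, and the resulting
form of the counting lemma with the norm part as the ONLY external input.

## What is proved

* §1 **`isUnit_three_iwasawaAlgebra_two`**: `3 ∈ Λˣ`, `Λ = ℤ₂⟦T⟧` (constant coefficient `3 ∈ ℤ₂ˣ`, `2 ∤ 3`).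
* §2 (any commutative ring `R` with `3 ∈ Rˣ`, any `R`-module `X` with an `R`-linear action of `Q`, `σ³ = 1` on `X`; write
  `N = 1 + σ + σ²`): `N ∘ N = 3N` (`norm_comp_norm_eq_three_smul`); **`isCompl_range_norm_ker_norm`**: `X = NX ⊕ ker N`
  (`e₁ = 3⁻¹N` is an idempotent with image `NX` and kernel `ker N = W`); `range_norm_eq_fixed`: `NX = X^σ = ker(σ − 1)`.
* §3 (`R = Λ`): **`lengthAt_eq_lengthAt_range_norm_add`**: `ℓ_𝔭(X) = ℓ_𝔭(NX) + ℓ_𝔭(W)` at every prime `𝔭`; hence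
  **`finite_sigmaEquivariant_of_lengthAt_eq_zero`** (`ℓ₍₂₎(X) = 0 ⟹ Hom_σ(X, V₄)` finite — NO input on the norm part:
  the direction «classical `μ₂ = 0` ⟹ (A)₂» of the note needs no Ferrero–Washington), and, given `ℓ₍₂₎(NX) = 0`,
  **`finite_sigmaEquivariant_iff_lengthAt_eq_zero_of_norm`**, **`finite_equivariant_iff_isTorsion_and_muInvariant_eq_zero_S3_of_norm`**,
  **`finite_equivariant_iff_isTorsion_and_muInvariant_eq_zero_of_no_transposition_of_norm`**:
  `Hom_Q(X, V₄)` finite ⟺ `X` is `Λ`-torsion with `μ(X) = 0`.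

Not here: the identification of `NX(F_∞)` with a quotient of `j(X(K_∞))` (class field theory: `j ∘ N_{F/K} = 1 + σ + σ²`
on ideal classes) and Ferrero–Washington itself (tree fact `ferreroWashington1979_classicalMuVanishes`) — typing.

References: J.-P. Serre, *Linear Representations of Finite Groups*, §2.6 (isotypic projectors); L. Washington,
*Cyclotomic Fields*, §13.2; PERFECT-DESCENT.md §3 (iii)–(iv) (lead att-p2 g4).
-/

set_option autoImplicit false
-- the Theorems namespace of this sub repeats the summit name by design (D-0017 nested layout)
set_option linter.dupNamespace false

noncomputable section

namespace Summit.BirchSwinnertonDyer.BirchSwinnertonDyer.Theorems.AlignedTransportAtTwoFineRoad.PerfectDescent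

open Literature.NumberTheory.EllipticCurves Literature.NumberTheory.EllipticCurves.IwasawaAlgebra
  Literature.NumberTheory.EllipticCurves.Module

/-! ## §1 `3` is a unit of `Λ = ℤ₂⟦T⟧` -/

/-- **`3 ∈ ℤ₂⟦T⟧ˣ`**: a power series is a unit iff its constant coefficient is, and `3 ∈ ℤ₂ˣ` (`‖3‖₂ = 1`, i.e.
`2 ∤ 3`). This is what makes `e₁ = 3⁻¹(1 + σ + σ²)` an honest idempotent on `Λ`-modules. [cite: Washington1997, §13.2] -/
theorem isUnit_three_iwasawaAlgebra_two : IsUnit (3 : IwasawaAlgebra 2) := by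
  rw [PowerSeries.isUnit_iff_constantCoeff, map_ofNat, PadicInt.isUnit_iff]
  have h : ((3 : ℕ) : ℤ_[2]) = 3 := Nat.cast_ofNat
  rw [← h, PadicInt.norm_natCast_eq_one_iff]
  decide

/-! ## §2 The `e₁`-splitting `X = (1 + σ + σ²)X ⊕ ker(1 + σ + σ²)` when `3` is a unit -/

section Splitting

variable {Q : Type*} [Group Q] {R : Type*} [CommRing R]
  {X : Type*} [AddCommGroup X] [_root_.Module R X] [DistribMulAction Q X] [SMulCommClass Q R X]

/-- The norm element applied twice: `(1 + σ + σ²)² = 3(1 + σ + σ²)` on `X` when `σ³ = 1`. [folklore] -/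
theorem norm_comp_norm_eq_three_smul {σ : Q} (hσ3 : ∀ x : X, σ • (σ • (σ • x)) = x) (x : X) :
    (LinearMap.id + DistribSMul.toLinearMap R X σ + (DistribSMul.toLinearMap R X σ).comp
        (DistribSMul.toLinearMap R X σ) : X →ₗ[R] X)
      ((LinearMap.id + DistribSMul.toLinearMap R X σ + (DistribSMul.toLinearMap R X σ).comp
        (DistribSMul.toLinearMap R X σ) : X →ₗ[R] X) x) =
      (3 : R) • (LinearMap.id + DistribSMul.toLinearMap R X σ + (DistribSMul.toLinearMap R X σ).comp
        (DistribSMul.toLinearMap R X σ) : X →ₗ[R] X) x := by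
  have e3 : ∀ y : X, (3 : R) • y = y + y + y := fun y ↦ by
    rw [show (3 : R) = 1 + 1 + 1 by norm_num, add_smul, add_smul, one_smul]
  rw [e3]
  simp only [LinearMap.add_apply, LinearMap.id_apply, LinearMap.comp_apply, DistribSMul.toLinearMap_apply,
    smul_add, hσ3]
  abel

/-- **`(1 + σ + σ²)X = X^σ`**: the image of the norm element is the module of `σ`-invariants `ker(σ − 1)`, when `3`
is a unit of `R` and `σ³ = 1` (`σ N = N`; conversely `x = N(3⁻¹x)` for `σx = x`). [folklore] -/
theorem range_norm_eq_fixed (h3 : IsUnit (3 : R)) {σ : Q} (hσ3 : ∀ x : X, σ • (σ • (σ • x)) = x) :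
    LinearMap.range (LinearMap.id + DistribSMul.toLinearMap R X σ + (DistribSMul.toLinearMap R X σ).comp
        (DistribSMul.toLinearMap R X σ)) =
      LinearMap.ker (DistribSMul.toLinearMap R X σ - LinearMap.id) := by
  obtain ⟨u, hu⟩ := h3.exists_left_inv
  ext x
  simp only [LinearMap.mem_range, LinearMap.mem_ker, LinearMap.add_apply, LinearMap.sub_apply,
    LinearMap.id_apply, LinearMap.comp_apply, DistribSMul.toLinearMap_apply, sub_eq_zero]
  constructor
  · rintro ⟨y, rfl⟩
    rw [smul_add, smul_add, hσ3]
    abel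
  · intro hx
    refine ⟨u • x, ?_⟩
    rw [smul_comm σ u x, smul_comm σ u (σ • x), hx, hx, ← add_smul, ← add_smul,
      show u + u + u = u * 3 by ring, hu, one_smul]

/-- **The `e₁`-splitting `X = (1 + σ + σ²)X ⊕ ker(1 + σ + σ²)`** (`R` any commutative ring with `3 ∈ Rˣ`, `Q` acting
`R`-linearly, `σ³ = 1` on `X`): `e₁ = 3⁻¹(1 + σ + σ²)` is an idempotent (`N² = 3N`) with image `NX` and kernel
`ker N`, so the two are complementary submodules (Mathlib `LinearMap.isCompl_of_proj`).
[cite: SerreGaloisCohomology1997, I §5.1] -/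
theorem isCompl_range_norm_ker_norm (h3 : IsUnit (3 : R)) {σ : Q} (hσ3 : ∀ x : X, σ • (σ • (σ • x)) = x) :
    IsCompl
      (LinearMap.range (LinearMap.id + DistribSMul.toLinearMap R X σ + (DistribSMul.toLinearMap R X σ).comp
        (DistribSMul.toLinearMap R X σ)))
      (LinearMap.ker (LinearMap.id + DistribSMul.toLinearMap R X σ + (DistribSMul.toLinearMap R X σ).comp
        (DistribSMul.toLinearMap R X σ))) := by
  obtain ⟨u, hu⟩ := h3.exists_left_inv
  set N := LinearMap.id + DistribSMul.toLinearMap R X σ + (DistribSMul.toLinearMap R X σ).comp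
    (DistribSMul.toLinearMap R X σ) with hN
  have hNN : ∀ x : X, N (N x) = (3 : R) • N x := norm_comp_norm_eq_three_smul hσ3
  -- the idempotent `e₁ = u • N`, as a map onto `range N`
  let f : X →ₗ[R] LinearMap.range N := (u • N).codRestrict (LinearMap.range N) (fun x ↦ by
    rw [LinearMap.smul_apply, ← LinearMap.map_smul]
    exact LinearMap.mem_range_self N _)
  have hf : ∀ x : X, ((f x : LinearMap.range N) : X) = u • N x := fun _ ↦ rfl
  have hproj : ∀ y : LinearMap.range N, f y = y := by
    rintro ⟨_, x, rfl⟩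
    apply Subtype.ext
    rw [hf, hNN, smul_smul, hu, one_smul]
  have hker : LinearMap.ker f = LinearMap.ker N := by
    ext x
    rw [LinearMap.mem_ker, LinearMap.mem_ker, ← Subtype.coe_inj, hf, Submodule.coe_zero]
    constructor
    · intro h
      have h' : (3 : R) • (u • N x) = 0 := by rw [h, smul_zero]
      rwa [smul_smul, mul_comm, hu, one_smul] at h'
    · intro h
      rw [h, smul_zero]
  rw [← hker]
  exact LinearMap.isCompl_of_proj hproj

end Splitting

/-! ## §3 Over `Λ = ℤ₂⟦T⟧`: `ℓ(X) = ℓ((1 + σ + σ²)X) + ℓ(W)`, and the counting lemma with the norm part as input -/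

section LambdaSplit

variable {Q : Type*} [Group Q] {M : Type*} [AddCommGroup M] [DistribMulAction Q M]
  {X : Type*} [AddCommGroup X] [_root_.Module (IwasawaAlgebra 2) X] [DistribMulAction Q X]
  [SMulCommClass Q (IwasawaAlgebra 2) X]

/-- **Additivity of local lengths along the `e₁`-splitting**: for a `Λ = ℤ₂⟦T⟧`-module `X` with `Λ`-linear `Q`-action
and `σ³ = 1` on `X`, at every prime `𝔭` of `Λ`: `ℓ_𝔭(X) = ℓ_𝔭((1 + σ + σ²)X) + ℓ_𝔭(ker(1 + σ + σ²))`
(`X ≅ NX × W`, `lengthAt_prod`). At `𝔭 = (2)`: `μ(X) = μ(e₁X) + μ((1 − e₁)X)` in the note's notation.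
[cite: Washington1997, §13.2] -/
theorem lengthAt_eq_lengthAt_range_norm_add {σ : Q} (hσ3 : ∀ x : X, σ • (σ • (σ • x)) = x)
    (𝔭 : PrimeSpectrum (IwasawaAlgebra 2)) :
    lengthAt (IwasawaAlgebra 2) X 𝔭 =
      lengthAt (IwasawaAlgebra 2)
          (LinearMap.range (LinearMap.id + DistribSMul.toLinearMap (IwasawaAlgebra 2) X σ +
            (DistribSMul.toLinearMap (IwasawaAlgebra 2) X σ).comp
              (DistribSMul.toLinearMap (IwasawaAlgebra 2) X σ))) 𝔭 +
        lengthAt (IwasawaAlgebra 2)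
          (LinearMap.ker (LinearMap.id + DistribSMul.toLinearMap (IwasawaAlgebra 2) X σ +
            (DistribSMul.toLinearMap (IwasawaAlgebra 2) X σ).comp
              (DistribSMul.toLinearMap (IwasawaAlgebra 2) X σ))) 𝔭 := by
  rw [← lengthAt_prod, ← lengthAt_eq_of_linearEquiv
    (Submodule.prodEquivOfIsCompl _ _ (isCompl_range_norm_ker_norm isUnit_three_iwasawaAlgebra_two hσ3)) 𝔭]

/-- **`ℓ₍₂₎(X) = 0 ⟹ Hom_σ(X, V₄)` finite** (finitely generated `X` over `Λ = ℤ₂⟦T⟧`, `σ` fixed-point-free on the Klein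
four-group `M`, `σ³ = 1` on `X`): `ℓ₍₂₎(W) ≤ ℓ₍₂₎(X)`, then part X. No hypothesis on the norm part — the direction
«`X` torsion with `μ(X) = 0` ⟹ `Hom_σ(X/2X, V₄)` finite» of PERFECT-DESCENT.md §3 (iii) is unconditional.
[cite: SerreGaloisCohomology1997, I §5.1] [cite: Washington1997, §13.2] -/
theorem finite_sigmaEquivariant_of_lengthAt_eq_zero [Module.Finite (IwasawaAlgebra 2) X]
    (h4 : Nat.card M = 4) (h2 : ∀ m : M, m + m = 0) {σ : Q} (hσ : ∀ m : M, σ • m = m → m = 0)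
    (hσ3 : ∀ x : X, σ • (σ • (σ • x)) = x)
    (h0 : lengthAt (IwasawaAlgebra 2) X ⟨augIdealP 2, isPrime_augIdealP_holds 2⟩ = 0) :
    Finite {f : X →+ M // ∀ x : X, f (σ • x) = σ • f x} := by
  rw [finite_sigmaEquivariant_iff_lengthAt_eq_zero h4 h2 hσ hσ3]
  have h := lengthAt_eq_lengthAt_range_norm_add (X := X) hσ3 ⟨augIdealP 2, isPrime_augIdealP_holds 2⟩
  rw [h0] at h
  exact nonpos_iff_eq_zero.mp (h.symm ▸ le_add_self)

/-- **Counting lemma, `σ`-form, with the norm part as input**: if `ℓ₍₂₎((1 + σ + σ²)X) = 0` (in the application: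
`(1 + σ + σ²)X(F_∞) ⊆ j(X(K_∞))` and Ferrero–Washington for the abelian field `K = ℚ(√Δ_E)`), then
`Hom_σ(X, V₄)` is finite ⟺ `ℓ₍₂₎(X) = 0`. [cite: SerreGaloisCohomology1997, I §5.1] [cite: Washington1997, §13.2] -/
theorem finite_sigmaEquivariant_iff_lengthAt_eq_zero_of_norm [Module.Finite (IwasawaAlgebra 2) X]
    (h4 : Nat.card M = 4) (h2 : ∀ m : M, m + m = 0) {σ : Q} (hσ : ∀ m : M, σ • m = m → m = 0)
    (hσ3 : ∀ x : X, σ • (σ • (σ • x)) = x)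
    (hN : lengthAt (IwasawaAlgebra 2)
      (LinearMap.range (LinearMap.id + DistribSMul.toLinearMap (IwasawaAlgebra 2) X σ +
        (DistribSMul.toLinearMap (IwasawaAlgebra 2) X σ).comp
          (DistribSMul.toLinearMap (IwasawaAlgebra 2) X σ))) ⟨augIdealP 2, isPrime_augIdealP_holds 2⟩ = 0) :
    Finite {f : X →+ M // ∀ x : X, f (σ • x) = σ • f x} ↔
      lengthAt (IwasawaAlgebra 2) X ⟨augIdealP 2, isPrime_augIdealP_holds 2⟩ = 0 := by
  rw [finite_sigmaEquivariant_iff_lengthAt_eq_zero h4 h2 hσ hσ3,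
    lengthAt_eq_lengthAt_range_norm_add (X := X) hσ3 ⟨augIdealP 2, isPrime_augIdealP_holds 2⟩, hN, zero_add]

/-- **Λ-ADIC COUNTING LEMMA with the norm part as input, `Q̄ = S₃`** (PERFECT-DESCENT.md §3 (iii)–(iv), module half):
`Q` acts on the Klein four-group `M` through `Aut(M) ≅ S₃` (`σ` fixed-point-free, `τ ≠ 1` fixing `m₀ ≠ 0`) and
`Λ`-linearly on the finitely generated `Λ = ℤ₂⟦T⟧`-module `X`, the kernel of the action on `M` acting trivially on `X`.
IF the norm part `(1 + σ + σ²)X = e₁X` has `ℓ₍₂₎ = 0` (torsion with `μ = 0` — the Ferrero–Washington input), THEN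
`Hom_Q(X, V₄)` (`= Hom_Q(X/2X, V₄)`) is finite ⟺ `X` is `Λ`-torsion with `μ(X) = 0`.
[cite: SerreGaloisCohomology1997, I §5.1] [cite: Washington1997, §13.2] -/
theorem finite_equivariant_iff_isTorsion_and_muInvariant_eq_zero_S3_of_norm
    [Module.Finite (IwasawaAlgebra 2) X] (h4 : Nat.card M = 4) (h2 : ∀ m : M, m + m = 0) {σ τ : Q}
    {m₀ : M} (hσ : ∀ m : M, σ • m = m → m = 0) (hm₀ : m₀ ≠ 0) (hτ0 : τ • m₀ = m₀)
    (hτ : ¬ ∀ m : M, τ • m = m) (hVN : ∀ g : Q, (∀ m : M, g • m = m) → ∀ x : X, g • x = x)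
    (hN : lengthAt (IwasawaAlgebra 2)
      (LinearMap.range (LinearMap.id + DistribSMul.toLinearMap (IwasawaAlgebra 2) X σ +
        (DistribSMul.toLinearMap (IwasawaAlgebra 2) X σ).comp
          (DistribSMul.toLinearMap (IwasawaAlgebra 2) X σ))) ⟨augIdealP 2, isPrime_augIdealP_holds 2⟩ = 0) :
    Finite {f : X →+ M // ∀ (g : Q) (x : X), f (g • x) = g • f x} ↔
      Module.IsTorsion (IwasawaAlgebra 2) X ∧ muInvariant 2 X = 0 := by
  rw [finite_equivariant_iff_sigmaEquivariant_S3 h4 h2 hσ hm₀ hτ0 hτ hVN,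
    finite_sigmaEquivariant_iff_lengthAt_eq_zero_of_norm h4 h2 hσ
      (smul_smul_smul_eq_self_of_kernel h4 h2 hσ hVN) hN,
    lengthAt_augIdealP_eq_zero_iff_isTorsion_and_muInvariant_eq_zero]

/-- **Λ-ADIC COUNTING LEMMA with the norm part as input, `Q̄ = C₃`** (the case `G_∞ ≅ C₃`, `ℚ(√Δ_E) ⊂ ℚ_∞`): as
`finite_equivariant_iff_isTorsion_and_muInvariant_eq_zero_S3_of_norm` with no element of `Q` acting as a transposition.
[cite: SerreGaloisCohomology1997, I §5.1] [cite: Washington1997, §13.2] -/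
theorem finite_equivariant_iff_isTorsion_and_muInvariant_eq_zero_of_no_transposition_of_norm
    [Module.Finite (IwasawaAlgebra 2) X] (h4 : Nat.card M = 4) (h2 : ∀ m : M, m + m = 0) {σ : Q}
    (hσ : ∀ m : M, σ • m = m → m = 0)
    (hnoT : ∀ g : Q, (∀ m : M, g • m = m) ∨ (∀ m : M, g • m = m → m = 0))
    (hVN : ∀ g : Q, (∀ m : M, g • m = m) → ∀ x : X, g • x = x)
    (hN : lengthAt (IwasawaAlgebra 2)
      (LinearMap.range (LinearMap.id + DistribSMul.toLinearMap (IwasawaAlgebra 2) X σ +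
        (DistribSMul.toLinearMap (IwasawaAlgebra 2) X σ).comp
          (DistribSMul.toLinearMap (IwasawaAlgebra 2) X σ))) ⟨augIdealP 2, isPrime_augIdealP_holds 2⟩ = 0) :
    Finite {f : X →+ M // ∀ (g : Q) (x : X), f (g • x) = g • f x} ↔
      Module.IsTorsion (IwasawaAlgebra 2) X ∧ muInvariant 2 X = 0 := by
  rw [finite_equivariant_iff_sigmaEquivariant_of_no_transposition h4 h2 hσ hnoT hVN,
    finite_sigmaEquivariant_iff_lengthAt_eq_zero_of_norm h4 h2 hσ
      (smul_smul_smul_eq_self_of_kernel h4 h2 hσ hVN) hN,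
    lengthAt_augIdealP_eq_zero_iff_isTorsion_and_muInvariant_eq_zero]

/-- **The unconditional direction for `Q̄ ≤ S₃`**: if `X` is `Λ`-torsion with `μ(X) = 0` then `Hom_Q(X, V₄)` is finite
(no hypothesis on the norm part; `Hom_Q ⊆ Hom_σ`). In the note's dictionary: «`μ₂(F) = 0 ⟹ (A)₂`» needs neither
Ferrero–Washington nor the transposition. [cite: SerreGaloisCohomology1997, I §5.1] [cite: Washington1997, §13.2] -/
theorem finite_equivariant_of_isTorsion_of_muInvariant_eq_zero [Module.Finite (IwasawaAlgebra 2) X]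
    (h4 : Nat.card M = 4) (h2 : ∀ m : M, m + m = 0) {σ : Q} (hσ : ∀ m : M, σ • m = m → m = 0)
    (hVN : ∀ g : Q, (∀ m : M, g • m = m) → ∀ x : X, g • x = x)
    (hT : Module.IsTorsion (IwasawaAlgebra 2) X) (hμ : muInvariant 2 X = 0) :
    Finite {f : X →+ M // ∀ (g : Q) (x : X), f (g • x) = g • f x} := by
  haveI := finite_sigmaEquivariant_of_lengthAt_eq_zero h4 h2 hσ
    (smul_smul_smul_eq_self_of_kernel h4 h2 hσ hVN)
    ((lengthAt_augIdealP_eq_zero_iff_isTorsion_and_muInvariant_eq_zero 2 (Y := X)).mpr ⟨hT, hμ⟩)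
  exact Finite.of_injective
    (fun f : {f : X →+ M // ∀ (g : Q) (x : X), f (g • x) = g • f x} ↦
      (⟨f.1, f.2 σ⟩ : {f : X →+ M // ∀ x : X, f (σ • x) = σ • f x})) fun f g h ↦
      Subtype.ext (congrArg (fun x : {f : X →+ M // ∀ x : X, f (σ • x) = σ • f x} ↦ x.1) h)

end LambdaSplit

end Summit.BirchSwinnertonDyer.BirchSwinnertonDyer.Theorems.AlignedTransportAtTwoFineRoad.PerfectDescent

end
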